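import Summits.Ventures.PercRepro.C025ProfilePLDTruncate
import Summits.Ventures.PercRepro.C025ProfilePLDClosureDisjointSum
import Summits.Ventures.PercRepro.C025ProfileTwoFlatPLDArith
import Summits.Ventures.PercRepro.C025ProfilePLDClosureParallel

/-!
# PER-LAYER DOMINANCE FOR TWO FAT FLATS AS A MATROID THEOREM: `U_{s₁,F₁} ⊕ U_{s₂,F₂}` (night-3 g30)

`proofs/NIGHT3-G30-PAREXT.md` §7.  g27 proved the two-flat (PLD) inequality in arithmetic form (`TwoFlatPLD.pld_arith`: sums
over `(i₁, i₂)` weighted by `C(k₁,i₁)·C(k₂,i₂)`).  Here it becomes the hPLD binder of the landed bridge for the MATROID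
`(truncate (freeOn F₁) s₁) ⊕ (truncate (freeOn F₂) s₂)` — the uniform matroid `U_{s,F}` is the truncation of the free matroid on
`F` — through g29's convolution identity `PLDClosure.sum_powerset_disjointSum` and the count of subsets of `F` by cardinality
(`sum_powerset_truncate_freeOn`, from `Finset.sum_powerset_apply_card`).  With the truncation, parallel-class and
parallel-extension closures, (PLD) — and C-025 on every truncation of `· ⊕ free points` — now holds on every
`T_r(U_{s₁,F₁} ⊕ U_{s₂,F₂} ⊕ parallel classes)` and their parallel extensions (e.g. rank-4 matroids with two skew lines and free
points).  No `def`, no `instance`, no notation.  Axioms: standard.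
-/

open scoped Matroid

namespace PercRepro

open Finset ThmH

namespace PLDTruncate

variable {α : Type} [DecidableEq α]

omit [DecidableEq α] in
/-- The free matroid on a finset is finite (a theorem, not an instance). -/
theorem freeOn_finite' (F : Finset α) : (Matroid.freeOn (F : Set α)).Finite :=
  ⟨by rw [Matroid.freeOn_ground]; exact F.finite_toSet⟩

omit [DecidableEq α] in
/-- The ground finset of `U_{s,F} = truncate (freeOn F) s`. -/
theorem gr_truncate_freeOn (F : Finset α) (s : ℕ) :
    haveI := freeOn_finite' F
    gr (Matroid.truncate (Matroid.freeOn (F : Set α)) s) = F := by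
  haveI := freeOn_finite' F
  rw [PLDBridge.gr_truncate]
  apply Finset.coe_injective
  rw [coe_gr, Matroid.freeOn_ground]

omit [DecidableEq α] in
/-- The rank of `I ⊆ F` in `U_{s,F}` is `min |I| s`. -/
theorem toNat_eRk_truncate_freeOn (F : Finset α) (s : ℕ) (I : Finset α) (hI : I ⊆ F) :
    haveI := freeOn_finite' F
    ((Matroid.truncate (Matroid.freeOn (F : Set α)) s).eRk (I : Set α)).toNat = min I.card s := by
  haveI := freeOn_finite' F
  rw [toNat_truncate_eRk, Matroid.eRk_freeOn (Finset.coe_subset.2 hI), Set.encard_coe_eq_coe_finsetCard,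
    ENat.toNat_coe]

/-- THE PROFILE OF A UNIFORM MATROID: `Σ_{I ⊆ F} G(ρI, ρ(F∖I)) = Σ_i C(|F|, i)·G(min i s, min (|F|−i) s)`. -/
theorem sum_powerset_truncate_freeOn (F : Finset α) (s : ℕ) (G : ℕ → ℕ → ℕ) :
    haveI := freeOn_finite' F
    ∑ I ∈ (gr (Matroid.truncate (Matroid.freeOn (F : Set α)) s)).powerset,
        G ((Matroid.truncate (Matroid.freeOn (F : Set α)) s).eRk (I : Set α)).toNat
          ((Matroid.truncate (Matroid.freeOn (F : Set α)) s).eRk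
            ((gr (Matroid.truncate (Matroid.freeOn (F : Set α)) s) \ I : Finset α) : Set α)).toNat =
      ∑ i ∈ range (F.card + 1), F.card.choose i * G (min i s) (min (F.card - i) s) := by
  haveI := freeOn_finite' F
  rw [gr_truncate_freeOn]
  have hterm : ∀ I ∈ F.powerset,
      G ((Matroid.truncate (Matroid.freeOn (F : Set α)) s).eRk (I : Set α)).toNat
          ((Matroid.truncate (Matroid.freeOn (F : Set α)) s).eRk ((F \ I : Finset α) : Set α)).toNat =
        G (min I.card s) (min (F.card - I.card) s) := by
    intro I hI
    rw [Finset.mem_powerset] at hI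
    rw [toNat_eRk_truncate_freeOn F s I hI, toNat_eRk_truncate_freeOn F s (F \ I) Finset.sdiff_subset,
      Finset.card_sdiff_of_subset hI]
  rw [Finset.sum_congr rfl hterm, Finset.sum_powerset_apply_card (fun m => G (min m s) (min (F.card - m) s))]
  simp only [smul_eq_mul]

/-- PER-LAYER DOMINANCE FOR `U_{s₁,F₁} ⊕ U_{s₂,F₂}`, in the hPLD binder of `PLDBridge.rls_disjointSum_freeOn_of_pld` —
g27's `TwoFlatPLD.pld_arith` read on the matroid. -/
theorem pld_twoFlat (F₁ F₂ : Finset α) (s₁ s₂ : ℕ)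
    (h : Disjoint (@Matroid.truncate α (Matroid.freeOn (F₁ : Set α)) (freeOn_finite' F₁) s₁).E
      (@Matroid.truncate α (Matroid.freeOn (F₂ : Set α)) (freeOn_finite' F₂) s₂).E) :
    haveI := freeOn_finite' F₁
    haveI := freeOn_finite' F₂
    haveI := PLDClosure.disjointSum_finite' _ _ h
    ∀ lo hi δ Θ : ℕ, Θ ≤ lo + hi + δ → (lo = 0 ∨ lo + hi + δ ≤ Θ) →
      (∑ I ∈ (gr ((Matroid.truncate (Matroid.freeOn (F₁ : Set α)) s₁).disjointSum
            (Matroid.truncate (Matroid.freeOn (F₂ : Set α)) s₂) h)).powerset,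
        (if lo ≤ (((Matroid.truncate (Matroid.freeOn (F₁ : Set α)) s₁).disjointSum
              (Matroid.truncate (Matroid.freeOn (F₂ : Set α)) s₂) h).eRk (I : Set α)).toNat ∧
            (((Matroid.truncate (Matroid.freeOn (F₁ : Set α)) s₁).disjointSum
              (Matroid.truncate (Matroid.freeOn (F₂ : Set α)) s₂) h).eRk (I : Set α)).toNat ≤ hi ∧
            Θ ≤ (((Matroid.truncate (Matroid.freeOn (F₁ : Set α)) s₁).disjointSum
              (Matroid.truncate (Matroid.freeOn (F₂ : Set α)) s₂) h).eRk
                ((gr ((Matroid.truncate (Matroid.freeOn (F₁ : Set α)) s₁).disjointSum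
                  (Matroid.truncate (Matroid.freeOn (F₂ : Set α)) s₂) h) \ I : Finset α) : Set α)).toNat +
              (((Matroid.truncate (Matroid.freeOn (F₁ : Set α)) s₁).disjointSum
                (Matroid.truncate (Matroid.freeOn (F₂ : Set α)) s₂) h).eRk (I : Set α)).toNat then
          ((((Matroid.truncate (Matroid.freeOn (F₁ : Set α)) s₁).disjointSum
            (Matroid.truncate (Matroid.freeOn (F₂ : Set α)) s₂) h).eRk
              ((gr ((Matroid.truncate (Matroid.freeOn (F₁ : Set α)) s₁).disjointSum
                (Matroid.truncate (Matroid.freeOn (F₂ : Set α)) s₂) h) \ I : Finset α) : Set α)).toNat).choose δ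
        else 0)) ≤
      ∑ I ∈ (gr ((Matroid.truncate (Matroid.freeOn (F₁ : Set α)) s₁).disjointSum
            (Matroid.truncate (Matroid.freeOn (F₂ : Set α)) s₂) h)).powerset,
        (if lo + δ ≤ (((Matroid.truncate (Matroid.freeOn (F₁ : Set α)) s₁).disjointSum
              (Matroid.truncate (Matroid.freeOn (F₂ : Set α)) s₂) h).eRk
                ((gr ((Matroid.truncate (Matroid.freeOn (F₁ : Set α)) s₁).disjointSum
                  (Matroid.truncate (Matroid.freeOn (F₂ : Set α)) s₂) h) \ I : Finset α) : Set α)).toNat ∧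
            (((Matroid.truncate (Matroid.freeOn (F₁ : Set α)) s₁).disjointSum
              (Matroid.truncate (Matroid.freeOn (F₂ : Set α)) s₂) h).eRk
                ((gr ((Matroid.truncate (Matroid.freeOn (F₁ : Set α)) s₁).disjointSum
                  (Matroid.truncate (Matroid.freeOn (F₂ : Set α)) s₂) h) \ I : Finset α) : Set α)).toNat ≤ hi + δ then
          ((((Matroid.truncate (Matroid.freeOn (F₁ : Set α)) s₁).disjointSum
            (Matroid.truncate (Matroid.freeOn (F₂ : Set α)) s₂) h).eRk
              ((gr ((Matroid.truncate (Matroid.freeOn (F₁ : Set α)) s₁).disjointSum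
                (Matroid.truncate (Matroid.freeOn (F₂ : Set α)) s₂) h) \ I : Finset α) : Set α)).toNat).choose δ
        else 0) := by
  haveI := freeOn_finite' F₁
  haveI := freeOn_finite' F₂
  haveI := PLDClosure.disjointSum_finite' _ _ h
  intro lo hi δ Θ hΘ hlo
  have hL := PLDClosure.sum_powerset_disjointSum _ _ h
    (fun x f => if lo ≤ x ∧ x ≤ hi ∧ Θ ≤ f + x then f.choose δ else 0)
  have hR := PLDClosure.sum_powerset_disjointSum _ _ h
    (fun x f => if lo + δ ≤ f ∧ f ≤ hi + δ then f.choose δ else 0)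
  beta_reduce at hL hR
  rw [hL, hR]
  -- the inner sums over `F₂`
  have h2L : ∀ x₁ f₁ : ℕ,
      ∑ I₂ ∈ (gr (Matroid.truncate (Matroid.freeOn (F₂ : Set α)) s₂)).powerset,
        (if lo ≤ x₁ + ((Matroid.truncate (Matroid.freeOn (F₂ : Set α)) s₂).eRk (I₂ : Set α)).toNat ∧
            x₁ + ((Matroid.truncate (Matroid.freeOn (F₂ : Set α)) s₂).eRk (I₂ : Set α)).toNat ≤ hi ∧
            Θ ≤ f₁ + ((Matroid.truncate (Matroid.freeOn (F₂ : Set α)) s₂).eRk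
                ((gr (Matroid.truncate (Matroid.freeOn (F₂ : Set α)) s₂) \ I₂ : Finset α) : Set α)).toNat +
              (x₁ + ((Matroid.truncate (Matroid.freeOn (F₂ : Set α)) s₂).eRk (I₂ : Set α)).toNat) then
          (f₁ + ((Matroid.truncate (Matroid.freeOn (F₂ : Set α)) s₂).eRk
            ((gr (Matroid.truncate (Matroid.freeOn (F₂ : Set α)) s₂) \ I₂ : Finset α) : Set α)).toNat).choose δ
        else 0) =
      ∑ i₂ ∈ range (F₂.card + 1), F₂.card.choose i₂ *
        (if lo ≤ x₁ + min i₂ s₂ ∧ x₁ + min i₂ s₂ ≤ hi ∧ Θ ≤ f₁ + min (F₂.card - i₂) s₂ + (x₁ + min i₂ s₂) then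
          (f₁ + min (F₂.card - i₂) s₂).choose δ else 0) := by
    intro x₁ f₁
    have := sum_powerset_truncate_freeOn F₂ s₂
      (fun x₂ f₂ => if lo ≤ x₁ + x₂ ∧ x₁ + x₂ ≤ hi ∧ Θ ≤ f₁ + f₂ + (x₁ + x₂) then (f₁ + f₂).choose δ else 0)
    beta_reduce at this
    exact this
  have h2R : ∀ f₁ : ℕ,
      ∑ I₂ ∈ (gr (Matroid.truncate (Matroid.freeOn (F₂ : Set α)) s₂)).powerset,
        (if lo + δ ≤ f₁ + ((Matroid.truncate (Matroid.freeOn (F₂ : Set α)) s₂).eRk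
              ((gr (Matroid.truncate (Matroid.freeOn (F₂ : Set α)) s₂) \ I₂ : Finset α) : Set α)).toNat ∧
            f₁ + ((Matroid.truncate (Matroid.freeOn (F₂ : Set α)) s₂).eRk
              ((gr (Matroid.truncate (Matroid.freeOn (F₂ : Set α)) s₂) \ I₂ : Finset α) : Set α)).toNat ≤ hi + δ then
          (f₁ + ((Matroid.truncate (Matroid.freeOn (F₂ : Set α)) s₂).eRk
            ((gr (Matroid.truncate (Matroid.freeOn (F₂ : Set α)) s₂) \ I₂ : Finset α) : Set α)).toNat).choose δ
        else 0) =
      ∑ i₂ ∈ range (F₂.card + 1), F₂.card.choose i₂ *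
        (if lo + δ ≤ f₁ + min (F₂.card - i₂) s₂ ∧ f₁ + min (F₂.card - i₂) s₂ ≤ hi + δ then
          (f₁ + min (F₂.card - i₂) s₂).choose δ else 0) := by
    intro f₁
    have := sum_powerset_truncate_freeOn F₂ s₂
      (fun x₂ f₂ => if lo + δ ≤ f₁ + f₂ ∧ f₁ + f₂ ≤ hi + δ then (f₁ + f₂).choose δ else 0)
    beta_reduce at this
    exact this
  simp only [h2L, h2R]
  -- the outer sums over `F₁`
  have h1L := sum_powerset_truncate_freeOn F₁ s₁ (fun x₁ f₁ => ∑ i₂ ∈ range (F₂.card + 1), F₂.card.choose i₂ *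
    (if lo ≤ x₁ + min i₂ s₂ ∧ x₁ + min i₂ s₂ ≤ hi ∧ Θ ≤ f₁ + min (F₂.card - i₂) s₂ + (x₁ + min i₂ s₂) then
      (f₁ + min (F₂.card - i₂) s₂).choose δ else 0))
  have h1R := sum_powerset_truncate_freeOn F₁ s₁ (fun x₁ f₁ => ∑ i₂ ∈ range (F₂.card + 1), F₂.card.choose i₂ *
    (if lo + δ ≤ f₁ + min (F₂.card - i₂) s₂ ∧ f₁ + min (F₂.card - i₂) s₂ ≤ hi + δ then
      (f₁ + min (F₂.card - i₂) s₂).choose δ else 0))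
  beta_reduce at h1L h1R
  rw [h1L, h1R]
  have key := TwoFlatPLD.pld_arith F₁.card s₁ F₂.card s₂ lo hi δ Θ hΘ hlo
  simp only [Finset.mul_sum, mul_assoc] at key ⊢
  exact key

/-- (PLD) ON EVERY TRUNCATION OF «U_{s₁,F₁} ⊕ U_{s₂,F₂} ⊕ PARALLEL CLASSES» (free points are classes of one element) — e.g. every
rank-4 matroid consisting of two skew lines and free points, `T_4(U_{2,F₁} ⊕ U_{2,F₂} ⊕ U_{m,m})`. -/
theorem pld_truncate_twoFlat_parallelClasses {β : Type} [DecidableEq β] (F₁ F₂ : Finset α) (s₁ s₂ : ℕ)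
    (h : Disjoint (@Matroid.truncate α (Matroid.freeOn (F₁ : Set α)) (freeOn_finite' F₁) s₁).E
      (@Matroid.truncate α (Matroid.freeOn (F₂ : Set α)) (freeOn_finite' F₂) s₂).E)
    (c : α → β) (E₂ : Finset α)
    (h₂ : Disjoint ((@Matroid.truncate α (Matroid.freeOn (F₁ : Set α)) (freeOn_finite' F₁) s₁).disjointSum
      (@Matroid.truncate α (Matroid.freeOn (F₂ : Set α)) (freeOn_finite' F₂) s₂) h).E (E₂ : Set α)) (r : ℕ) :
    haveI := freeOn_finite' F₁
    haveI := freeOn_finite' F₂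
    haveI := PLDClosure.disjointSum_finite' _ _ h
    haveI := PLDClosure.disjointSum_comapOn_finite _ c E₂ h₂
    ∀ lo hi δ Θ : ℕ, Θ ≤ lo + hi + δ → (lo = 0 ∨ lo + hi + δ ≤ Θ) →
      (∑ I ∈ (gr (Matroid.truncate (((Matroid.truncate (Matroid.freeOn (F₁ : Set α)) s₁).disjointSum
            (Matroid.truncate (Matroid.freeOn (F₂ : Set α)) s₂) h).disjointSum
              ((Matroid.freeOn (Set.univ : Set β)).comapOn (E₂ : Set α) c) h₂) r)).powerset,
        (if lo ≤ ((Matroid.truncate (((Matroid.truncate (Matroid.freeOn (F₁ : Set α)) s₁).disjointSum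
              (Matroid.truncate (Matroid.freeOn (F₂ : Set α)) s₂) h).disjointSum
                ((Matroid.freeOn (Set.univ : Set β)).comapOn (E₂ : Set α) c) h₂) r).eRk (I : Set α)).toNat ∧
            ((Matroid.truncate (((Matroid.truncate (Matroid.freeOn (F₁ : Set α)) s₁).disjointSum
              (Matroid.truncate (Matroid.freeOn (F₂ : Set α)) s₂) h).disjointSum
                ((Matroid.freeOn (Set.univ : Set β)).comapOn (E₂ : Set α) c) h₂) r).eRk (I : Set α)).toNat ≤ hi ∧
            Θ ≤ ((Matroid.truncate (((Matroid.truncate (Matroid.freeOn (F₁ : Set α)) s₁).disjointSum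
              (Matroid.truncate (Matroid.freeOn (F₂ : Set α)) s₂) h).disjointSum
                ((Matroid.freeOn (Set.univ : Set β)).comapOn (E₂ : Set α) c) h₂) r).eRk
                  ((gr (Matroid.truncate (((Matroid.truncate (Matroid.freeOn (F₁ : Set α)) s₁).disjointSum
                    (Matroid.truncate (Matroid.freeOn (F₂ : Set α)) s₂) h).disjointSum
                      ((Matroid.freeOn (Set.univ : Set β)).comapOn (E₂ : Set α) c) h₂) r) \ I : Finset α) :
                    Set α)).toNat +
              ((Matroid.truncate (((Matroid.truncate (Matroid.freeOn (F₁ : Set α)) s₁).disjointSum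
                (Matroid.truncate (Matroid.freeOn (F₂ : Set α)) s₂) h).disjointSum
                  ((Matroid.freeOn (Set.univ : Set β)).comapOn (E₂ : Set α) c) h₂) r).eRk (I : Set α)).toNat then
          (((Matroid.truncate (((Matroid.truncate (Matroid.freeOn (F₁ : Set α)) s₁).disjointSum
            (Matroid.truncate (Matroid.freeOn (F₂ : Set α)) s₂) h).disjointSum
              ((Matroid.freeOn (Set.univ : Set β)).comapOn (E₂ : Set α) c) h₂) r).eRk
                ((gr (Matroid.truncate (((Matroid.truncate (Matroid.freeOn (F₁ : Set α)) s₁).disjointSum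
                  (Matroid.truncate (Matroid.freeOn (F₂ : Set α)) s₂) h).disjointSum
                    ((Matroid.freeOn (Set.univ : Set β)).comapOn (E₂ : Set α) c) h₂) r) \ I : Finset α) :
                  Set α)).toNat).choose δ
        else 0)) ≤
      ∑ I ∈ (gr (Matroid.truncate (((Matroid.truncate (Matroid.freeOn (F₁ : Set α)) s₁).disjointSum
            (Matroid.truncate (Matroid.freeOn (F₂ : Set α)) s₂) h).disjointSum
              ((Matroid.freeOn (Set.univ : Set β)).comapOn (E₂ : Set α) c) h₂) r)).powerset,
        (if lo + δ ≤ ((Matroid.truncate (((Matroid.truncate (Matroid.freeOn (F₁ : Set α)) s₁).disjointSum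
              (Matroid.truncate (Matroid.freeOn (F₂ : Set α)) s₂) h).disjointSum
                ((Matroid.freeOn (Set.univ : Set β)).comapOn (E₂ : Set α) c) h₂) r).eRk
                  ((gr (Matroid.truncate (((Matroid.truncate (Matroid.freeOn (F₁ : Set α)) s₁).disjointSum
                    (Matroid.truncate (Matroid.freeOn (F₂ : Set α)) s₂) h).disjointSum
                      ((Matroid.freeOn (Set.univ : Set β)).comapOn (E₂ : Set α) c) h₂) r) \ I : Finset α) :
                    Set α)).toNat ∧
            ((Matroid.truncate (((Matroid.truncate (Matroid.freeOn (F₁ : Set α)) s₁).disjointSum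
              (Matroid.truncate (Matroid.freeOn (F₂ : Set α)) s₂) h).disjointSum
                ((Matroid.freeOn (Set.univ : Set β)).comapOn (E₂ : Set α) c) h₂) r).eRk
                  ((gr (Matroid.truncate (((Matroid.truncate (Matroid.freeOn (F₁ : Set α)) s₁).disjointSum
                    (Matroid.truncate (Matroid.freeOn (F₂ : Set α)) s₂) h).disjointSum
                      ((Matroid.freeOn (Set.univ : Set β)).comapOn (E₂ : Set α) c) h₂) r) \ I : Finset α) :
                    Set α)).toNat ≤ hi + δ then
          (((Matroid.truncate (((Matroid.truncate (Matroid.freeOn (F₁ : Set α)) s₁).disjointSum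
            (Matroid.truncate (Matroid.freeOn (F₂ : Set α)) s₂) h).disjointSum
              ((Matroid.freeOn (Set.univ : Set β)).comapOn (E₂ : Set α) c) h₂) r).eRk
                ((gr (Matroid.truncate (((Matroid.truncate (Matroid.freeOn (F₁ : Set α)) s₁).disjointSum
                  (Matroid.truncate (Matroid.freeOn (F₂ : Set α)) s₂) h).disjointSum
                    ((Matroid.freeOn (Set.univ : Set β)).comapOn (E₂ : Set α) c) h₂) r) \ I : Finset α) :
                  Set α)).toNat).choose δ
        else 0) := by
  haveI := freeOn_finite' F₁
  haveI := freeOn_finite' F₂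
  haveI := PLDClosure.disjointSum_finite' _ _ h
  haveI := PLDClosure.disjointSum_comapOn_finite _ c E₂ h₂
  exact pld_truncate _ (PLDClosure.pld_disjointSum_parallelClasses _ (pld_twoFlat F₁ F₂ s₁ s₂ h) c E₂ h₂) r

end PLDTruncate

end PercRepro
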